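import Summits.AtomisticToContinuum.FouriersLaw.Theorems.CageBudgetFeketeHeatVarianceCalculusCanonicalMajorant
import Literature.MathematicalPhysics.KineticTheory.InfiniteChainSuperstableOrbits
import Literature.MathematicalPhysics.KineticTheory.InfiniteChainGibbsInvariance
import Literature.MathematicalPhysics.KineticTheory.InfiniteChainShiftInvariantUniqueness
import Literature.MathematicalPhysics.KineticTheory.InfiniteChainCurrentMoments
import HarnessLib

/-!
# Stub `stub_canonicalTwin` of line `regularity_collapse`, crux `HoelderEscapeProfile.AbelSpreadCeiling`
(item stmt-AtomisticToContinuum-16010; `--supports` file, closes nothing; line lead, 2026-08-17, cycle 1)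

WHAT. Registered stub 2 of the crux's skeleton (`Cruxes/AbelSpreadCeiling/Lines/regularity_collapse.lean`): for the
pinned anharmonic chain `pinnedChain ω₂ lam β γ` (`ω₂, lam, β > 0`), a shift- (and reversal-) invariant DLR state `μ`
at `T > 0` and ANY `μ`-preserving infinite-volume dynamics `D` (any carrier), there is a CANONICAL TWIN `D'`: carrier
equal to Buttà–Marchioro's good set `bmGood`, measurable flow maps, identity off `bmGood`, preserving `μ`, with
`D'.flow t = D.flow t` `μ`-a.e. at every time, absolutely convergent summed current correlations, and the same current
autocorrelation function `C_T`.

HOW (everything is in the tree). (1) `exists_bmDynamics`: the canonical dynamics `D♭` (carrier `bmGood`, measurable,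
identity off `bmGood`, preserving every superstable DLR state); (2) the shift-invariant DLR state is superstable
(`hasSuperstabilityEstimate_of_isShiftInvariant_pinnedChain`); (3) sup-in-time BM (2.6) for ANY preserving dynamics
(`ae_forall_flow_mem_bmGood_pinnedChain`): `μ`-a.e. orbit of `D` lies in `bmGood` at all times, hence (the `unique`
field of `D♭`) it IS the `D♭`-orbit — `D♭.flow t =ᵐ[μ] D.flow t`; (4) absolute convergence for the canonical pair from
the landed clustering majorant `HeatVarianceCalculus.CanonicalRigidity.stub_canonicalClusteringMajorant` and the `L²`
moments of the bond current (`memLp_bondCurrentZ_pinnedChain`); (5) equal `C_T` and transfer by `integral_congr_ae`.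
-/

noncomputable section

namespace Summit.AtomisticToContinuum.FouriersLaw.Theorems.AbelSpreadCeiling.RegularityCollapse

open MeasureTheory Filter Set Function
open scoped Topology BigOperators
open Literature.MathematicalPhysics.KineticTheory.HeatConduction

/-- **Flows agreeing a.e. have the same current pair correlations, the same absolute convergence and the same
summed autocorrelation.** [folklore] -/
theorem currentCorrelation_congr_ae {P : OscillatorChain} (D₁ D₂ : InfiniteChainDynamics P)
    (μ : Measure ChainConfig) (h : ∀ t : ℝ, D₁.flow t =ᵐ[μ] D₂.flow t) (t : ℝ) :
    D₁.currentCorrelation μ t = D₂.currentCorrelation μ t := by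
  unfold InfiniteChainDynamics.currentCorrelation
  refine tsum_congr fun x => integral_congr_ae ?_
  filter_upwards [h t] with σ hσ
  rw [hσ]

/-- Absolute convergence of the summed current correlation transfers along a.e.-equal flows. [folklore] -/
theorem hasAbsConvergentCorrelation_congr_ae {P : OscillatorChain} (D₁ D₂ : InfiniteChainDynamics P)
    (μ : Measure ChainConfig) (h : ∀ t : ℝ, D₁.flow t =ᵐ[μ] D₂.flow t) (t : ℝ)
    (h₁ : D₁.HasAbsConvergentCorrelation μ t) : D₂.HasAbsConvergentCorrelation μ t := by
  have hint : ∀ x : ℤ, (fun σ => P.bondCurrentZ σ 0 * P.bondCurrentZ (D₁.flow t σ) x) =ᵐ[μ]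
      fun σ => P.bondCurrentZ σ 0 * P.bondCurrentZ (D₂.flow t σ) x := fun x => by
    filter_upwards [h t] with σ hσ
    rw [hσ]
  refine ⟨fun x => (h₁.1 x).congr (hint x), ?_⟩
  have e : (fun x : ℤ => |∫ σ, P.bondCurrentZ σ 0 * P.bondCurrentZ (D₂.flow t σ) x ∂μ|) =
      fun x : ℤ => |∫ σ, P.bondCurrentZ σ 0 * P.bondCurrentZ (D₁.flow t σ) x ∂μ| := by
    funext x; rw [integral_congr_ae (hint x)]
  rw [e]; exact h₁.2

/-- **Stub `stub_canonicalTwin` (registered signature, verbatim).** Every dynamics preserving the shift-invariant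
DLR state of the pinned anharmonic chain is, almost everywhere and at all times, the canonical Buttà–Marchioro
dynamics: existence of a canonical twin with the same Green–Kubo objects.
[cite: ButtaMarchioro2016, §2 Thm 2.1 and eq. (2.6)] -/
theorem stub_canonicalTwin :
    ∀ ω₂ lam β γ : ℝ, 0 < ω₂ → 0 < lam → 0 < β → ∀ T : ℝ, 0 < T →
      ∀ μ : MeasureTheory.Measure ChainConfig, (pinnedChain ω₂ lam β γ).IsChainGibbsMeasure T μ →
      IsShiftInvariant μ → μ.map (fun σ : ChainConfig => fun x : ℤ => ((σ x).1, -(σ x).2)) = μ →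
      ∀ D : InfiniteChainDynamics (pinnedChain ω₂ lam β γ), D.PreservesMeasure μ →
      ∃ D' : InfiniteChainDynamics (pinnedChain ω₂ lam β γ),
        D'.carrier = (pinnedChain ω₂ lam β γ).bmGood ∧ (∀ t : ℝ, Measurable (D'.flow t)) ∧
        (∀ t : ℝ, ∀ σ ∉ (pinnedChain ω₂ lam β γ).bmGood, D'.flow t σ = σ) ∧
        D'.PreservesMeasure μ ∧ (∀ t : ℝ, D'.flow t =ᵐ[μ] D.flow t) ∧
        (∀ t : ℝ, D'.HasAbsConvergentCorrelation μ t) ∧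
        ∀ t : ℝ, D'.currentCorrelation μ t = D.currentCorrelation μ t := by
  intro ω₂ lam β γ hω hl hβ T hT μ hG hSI hR D hP
  -- the chain data: `U`, `V` even non-negative quartic polynomials
  have hU1 : OscillatorChain.IsEvenPolyOfDegree (pinnedChain ω₂ lam β γ).U 2 :=
    OscillatorChain.pinnedChain_isEvenPolyOfDegree_U β γ hω.le hl
  have hV1 : OscillatorChain.IsEvenPolyOfDegree (pinnedChain ω₂ lam β γ).V 2 :=
    OscillatorChain.pinnedChain_isEvenPolyOfDegree_V ω₂ lam γ hβ
  -- (1) the canonical Buttà–Marchioro dynamics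
  obtain ⟨D₀, hcar₀, hmeas₀, hid₀, -, -, -, hpres₀⟩ :=
    OscillatorChain.exists_bmDynamics (P := pinnedChain ω₂ lam β γ) (by norm_num) (by norm_num) hU1 hV1
  -- (2) the shift-invariant DLR state is superstable, hence preserved by `D₀`
  have hss : (pinnedChain ω₂ lam β γ).HasSuperstabilityEstimate μ :=
    OscillatorChain.hasSuperstabilityEstimate_of_isShiftInvariant_pinnedChain γ hω hl.le hβ.le hT hG hSI
  have hP₀ : D₀.PreservesMeasure μ := hpres₀ T μ hG hss
  -- (3) a.e. orbit of `D` is good at all times, hence is the `D₀`-orbit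
  have hgood : ∀ᵐ σ ∂μ, ∀ t : ℝ, D.flow t σ ∈ (pinnedChain ω₂ lam β γ).bmGood :=
    OscillatorChain.ae_forall_flow_mem_bmGood_pinnedChain γ hω.le hl hβ hss D hP
  have hae : ∀ t : ℝ, D₀.flow t =ᵐ[μ] D.flow t := fun t => by
    filter_upwards [hP.1, hgood] with σ hσ hg
    have hu := D₀.unique (fun s => D.flow s σ) (fun s => hcar₀ ▸ hg s) (D.isSolution σ hσ) t
    -- `hu : D.flow t σ = D₀.flow t (D.flow 0 σ)`
    rw [D.flow_zero σ hσ] at hu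
    exact hu.symm
  -- (4) absolute convergence for the canonical pair: landed clustering majorant + `L²` moments
  have hAC₀ : ∀ t : ℝ, D₀.HasAbsConvergentCorrelation μ t := by
    intro t
    obtain ⟨m, hm, hb⟩ :=
      Summit.AtomisticToContinuum.FouriersLaw.Theorems.HeatVarianceCalculus.CanonicalRigidity.stub_canonicalClusteringMajorant
        ω₂ lam β γ hω hl hβ T hT μ hG hSI hR D₀ hcar₀ hmeas₀ hid₀ |t|
    have h2 : ∀ x : ℤ, MemLp (fun σ => (pinnedChain ω₂ lam β γ).bondCurrentZ σ x) 2 μ := fun x =>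
      OscillatorChain.memLp_bondCurrentZ_pinnedChain γ hω.le hl.le hβ hss x (by norm_num)
    refine ⟨fun x => ?_, ?_⟩
    · have hY : MemLp (fun σ => (pinnedChain ω₂ lam β γ).bondCurrentZ (D₀.flow t σ) x) 2 μ :=
        (h2 x).comp_measurePreserving (hP₀.2 t)
      exact (h2 0).integrable_mul hY
    · refine Summable.of_nonneg_of_le (fun x => abs_nonneg _) (fun x => hb t le_rfl x) hm
  refine ⟨D₀, hcar₀, hmeas₀, hid₀, hP₀, hae, hAC₀, fun t => ?_⟩
  -- (5) the same `C_T`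
  exact currentCorrelation_congr_ae D₀ D μ hae t

/-- **Corollary: absolutely convergent summed current correlations for EVERY guarded pair** (clause (1) of
`HoelderEscapeProfile.FibreCalculus` / `CoercivePulse.PulseCalculus` / `CageBudgetFekete.HeatVarianceCalculus`): for the
pinned anharmonic chain, the shift- and reversal-invariant DLR state `μ` at `T > 0` and ANY `μ`-preserving dynamics `D`,
`Σ_x |∫ j_0 · (j_x ∘ φ_t) dμ| < ∞` with integrable summands, at every time `t` — transferred from the canonical twin
along the a.e. equality of the flows. [folklore] -/
theorem hasAbsConvergentCorrelation_of_preservesMeasure {ω₂ lam β γ : ℝ} (hω : 0 < ω₂) (hl : 0 < lam)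
    (hβ : 0 < β) {T : ℝ} (hT : 0 < T) {μ : MeasureTheory.Measure ChainConfig}
    (hG : (pinnedChain ω₂ lam β γ).IsChainGibbsMeasure T μ) (hSI : IsShiftInvariant μ)
    (hR : μ.map (fun σ : ChainConfig => fun x : ℤ => ((σ x).1, -(σ x).2)) = μ)
    (D : InfiniteChainDynamics (pinnedChain ω₂ lam β γ)) (hP : D.PreservesMeasure μ) (t : ℝ) :
    D.HasAbsConvergentCorrelation μ t := by
  obtain ⟨D', -, -, -, -, hae, hAC, -⟩ := stub_canonicalTwin ω₂ lam β γ hω hl hβ T hT μ hG hSI hR D hP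
  exact hasAbsConvergentCorrelation_congr_ae D' D μ hae t (hAC t)

end Summit.AtomisticToContinuum.FouriersLaw.Theorems.AbelSpreadCeiling.RegularityCollapse

end
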